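import Mathlib.NumberTheory.NumberField.CanonicalEmbedding.ConvexBody
import Literature.NumberTheory.Automorphic.AdeleRingTopology
import HarnessLib

/-!
# Strong approximation for the additive group of a number field

Topic `NumberTheory/Automorphic`; theorems only (no definition, no named fact). The **strong
approximation theorem** for the adele ring (Cassels–Fröhlich, *Algebraic Number Theory* (1967),
Ch. II (Cassels) §15, Theorem): *let `v₀` be a place of `K`; given a finite set `S ∌ v₀` of places,
elements `α_v ∈ K_v` (`v ∈ S`) and `ε > 0`, there is `β ∈ K` with `|β - α_v|_v < ε` for `v ∈ S`
and `|β|_v ≤ 1` for `v ∉ S`, `v ≠ v₀`* — i.e. `K + K_{v₀}` is dense in `𝔸_K`. We prove it for an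
archimedean `v₀ = σ₀` (the case used in the arithmetic of quaternion algebras: Eichler's
condition provides an archimedean place to leave free), in the following form
(`AdeleRing.strongApproximation_infinitePlace`): for every adele `x`, every `ε > 0` and every
finitely supported exponent vector `n : v ↦ n_v`, there is `k ∈ K` with
`‖(x - k)_σ‖ < ε` at the infinite places `σ ≠ σ₀` and `|(x - k)_v|_v ≤ q_v^{-n_v}` at *every*
finite place `v` (so `x - k` is integral wherever `n_v = 0`).

## Proof (Cassels–Fröhlich II §15)

`𝔸_K = K + (F × ∏_v 𝒪_v)` with `F ⊆ K_∞` compact (`AdeleRingTopology`: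
`FiniteAdeleRing.exists_forall_sub_algebraMap_mem`, `InfiniteAdeleRing.exists_isCompact_forall_exists_sub_mem`),
and `F` is bounded, say by `R`, at each infinite place. By Minkowski's theorem in the ideal
`𝔞 = ∏ 𝔭_v^{n_v}` (Mathlib `NumberField.mixedEmbedding.exists_ne_zero_mem_ideal_lt`, with the box
stretched at `σ₀` by `adjust_f`) there is `λ ∈ 𝔞 ∖ 0` with `σ(λ) < ε/(R+1)` for all `σ ≠ σ₀`.
Write `λ⁻¹ x = k₀ + w` with `w ∈ F × ∏ 𝒪_v`; then `k = λ k₀` works, since `x - k = λ w` has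
`‖(λ w)_σ‖ = σ(λ) ‖w_σ‖ < ε` for `σ ≠ σ₀` and `|(λ w)_v|_v ≤ |λ|_v ≤ q_v^{-n_v}` at the finite places.

## References

* J. W. S. Cassels, A. Fröhlich (eds.), *Algebraic Number Theory* (1967), Ch. II (Cassels,
  *Global fields*) §15, Theorem (strong approximation) [CasselsFrohlichANT1967].
* M.-F. Vignéras, *Arithmétique des algèbres de quaternions*, LNM 800 (1980), Ch. III §1
  Thm. 1.4 (3) and §4 (proof of Thm. 4.3: the choice of the trace `t`) [VignerasLNM800].
-/

noncomputable section

open NumberField IsDedekindDomain NumberField.InfinitePlace NumberField.mixedEmbedding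
open scoped NNReal ENNReal nonZeroDivisors

namespace Literature.NumberTheory.Automorphic

variable (K : Type) [Field K] [NumberField K]

/-! ### Minkowski: small non-zero elements of an ideal away from one infinite place -/

/-- **Minkowski with one stretched place**: for a non-zero ideal `𝔞 ⊆ 𝓞 K`, an infinite place `σ₀`
and `δ > 0` there is a non-zero `λ ∈ 𝔞` with `σ(λ) < δ` for every infinite place `σ ≠ σ₀`
(Mathlib's `exists_ne_zero_mem_ideal_lt` for the box `convexBodyLT K g`, `g = δ` off `σ₀` and
`g σ₀` large enough, `adjust_f`; Cassels–Fröhlich II §15, proof of the Theorem).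
[cite: CasselsFrohlichANT1967, Ch. II §15 (proof of Theorem)] -/
theorem exists_ne_zero_mem_ideal_forall_lt (𝔞 : Ideal (𝓞 K)) (h𝔞 : 𝔞 ≠ ⊥) (σ₀ : InfinitePlace K)
    {δ : ℝ} (hδ : 0 < δ) :
    ∃ r ∈ 𝔞, r ≠ 0 ∧ ∀ σ : InfinitePlace K, σ ≠ σ₀ → σ (r : K) < δ := by
  classical
  set I : (FractionalIdeal (𝓞 K)⁰ K)ˣ :=
    Units.mk0 (𝔞 : FractionalIdeal (𝓞 K)⁰ K) (FractionalIdeal.coeIdeal_ne_zero.mpr h𝔞) with hI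
  -- the target volume `B` with `minkowskiBound K I < convexBodyLTFactor K * B`
  obtain ⟨m, hm⟩ : ∃ m : ℝ≥0, minkowskiBound K I = m :=
    ⟨(minkowskiBound K I).toNNReal, (ENNReal.coe_toNNReal (minkowskiBound_lt_top K I).ne).symm⟩
  set B : ℝ≥0 := m / convexBodyLTFactor K + 1 with hB
  have hBvol : minkowskiBound K I < (convexBodyLTFactor K : ℝ≥0∞) * B := by
    rw [hm, ← ENNReal.coe_mul, ENNReal.coe_lt_coe, hB, mul_add, mul_one,
      mul_div_cancel₀ _ (convexBodyLTFactor_ne_zero K)]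
    exact lt_add_of_pos_right _ (pos_iff_ne_zero.mpr (convexBodyLTFactor_ne_zero K))
  -- the box: `δ` at `σ ≠ σ₀`, stretched at `σ₀`
  have hδ' : (⟨δ, hδ.le⟩ : ℝ≥0) ≠ 0 := fun h => hδ.ne' (congrArg Subtype.val h)
  set f : InfinitePlace K → ℝ≥0 := fun _ => ⟨δ, hδ.le⟩ with hf
  have hf0 : ∀ w, w ≠ σ₀ → f w ≠ 0 := fun _ _ => hδ'
  obtain ⟨g, hg₁, hg₂⟩ := adjust_f K B hf0
  have hvol : minkowskiBound K I < MeasureTheory.volume (convexBodyLT K g) := by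
    rw [convexBodyLT_volume, hg₂]
    exact hBvol
  obtain ⟨a, ha, ha0, halt⟩ := exists_ne_zero_mem_ideal_lt K I hvol
  rw [hI, Units.val_mk0, FractionalIdeal.mem_coeIdeal] at ha
  obtain ⟨r, hr, rfl⟩ := ha
  refine ⟨r, hr, fun h => ha0 (by rw [h, map_zero]), fun σ hσ => ?_⟩
  have h := halt σ
  rw [hg₁ σ hσ, hf] at h
  exact h

/-! ### Strong approximation leaving one infinite place free -/

/-- Valuation of a global element at a finite place, seen in the finite adeles. [folklore] -/
theorem valued_algebraMap_finiteAdele_apply (k : K) (v : HeightOneSpectrum (𝓞 K)) :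
    Valued.v (algebraMap K (FiniteAdeleRing (𝓞 K) K) k v) = v.valuation K k := by
  rw [FiniteAdeleRing.algebraMap_apply]
  exact HeightOneSpectrum.valuedAdicCompletion_eq_valuation' v k

/-- An element of `𝔞 = ∏ 𝔭_v^{n_v}` has `v`-adic valuation `≤ q_v^{-n_v}` at every finite place.
[folklore] -/
theorem valuation_le_exp_neg_of_mem_finsuppProd {n : HeightOneSpectrum (𝓞 K) →₀ ℕ} {r : 𝓞 K}
    (hr : r ∈ n.prod fun v e => v.asIdeal ^ e) (v : HeightOneSpectrum (𝓞 K)) :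
    v.valuation K (r : K) ≤ WithZero.exp (-(n v : ℤ)) := by
  rw [HeightOneSpectrum.valuation_of_algebraMap, HeightOneSpectrum.intValuation_le_pow_iff_dvd]
  have hdvd : v.asIdeal ^ n v ∣ n.prod fun v e => v.asIdeal ^ e := by
    by_cases hv : v ∈ n.support
    · exact Finset.dvd_prod_of_mem (fun w => w.asIdeal ^ n w) hv
    · rw [Finsupp.notMem_support_iff.mp hv, pow_zero]
      exact one_dvd _
  exact hdvd.trans ((Ideal.dvd_span_singleton).mpr hr)

/-- **Strong approximation theorem for the additive group, leaving one infinite place free**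
(Cassels–Fröhlich II §15, Theorem, case `v₀ = σ₀` archimedean): for every adele `x`, `ε > 0` and
finitely supported `n : v ↦ n_v ∈ ℕ` there is `k ∈ K` with `‖(x - k)_σ‖ < ε` at every infinite
place `σ ≠ σ₀` and `|(x - k)_v|_v ≤ q_v^{-n_v}` at every finite place `v` — i.e. `K + K_{σ₀}` is
dense in `𝔸_K`. [cite: CasselsFrohlichANT1967, Ch. II §15 Theorem (strong approximation)] -/
theorem AdeleRing.strongApproximation_infinitePlace (σ₀ : InfinitePlace K) (x : AdeleRing (𝓞 K) K)
    (n : HeightOneSpectrum (𝓞 K) →₀ ℕ) {ε : ℝ} (hε : 0 < ε) :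
    ∃ k : K, (∀ σ : InfinitePlace K, σ ≠ σ₀ →
        ‖(x - algebraMap K (AdeleRing (𝓞 K) K) k).1 σ‖ < ε) ∧
      ∀ v : HeightOneSpectrum (𝓞 K),
        Valued.v ((x - algebraMap K (AdeleRing (𝓞 K) K) k).2 v) ≤ WithZero.exp (-(n v : ℤ)) := by
  classical
  -- the fundamental set `F × ∏ 𝒪_v` and a bound `R` for `F`
  obtain ⟨F, hF, hFcov⟩ := InfiniteAdeleRing.exists_isCompact_forall_exists_sub_mem K
  have hbound : ∀ σ : InfinitePlace K, ∃ Rσ : ℝ, ∀ y ∈ F, ‖y σ‖ ≤ Rσ := fun σ => by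
    obtain ⟨Rσ, hRσ⟩ := (hF.image (continuous_apply σ)).isBounded.exists_norm_le
    exact ⟨Rσ, fun y hy => hRσ _ (Set.mem_image_of_mem _ hy)⟩
  choose Rσ hRσ using hbound
  set R : ℝ := (Finset.univ.sup' Finset.univ_nonempty fun σ => |Rσ σ|) with hR
  have hR0 : 0 ≤ R := (abs_nonneg (Rσ σ₀)).trans (Finset.le_sup' (fun σ => |Rσ σ|) (Finset.mem_univ σ₀))
  have hRle : ∀ σ, ∀ y ∈ F, ‖y σ‖ ≤ R := fun σ y hy =>
    ((hRσ σ y hy).trans (le_abs_self _)).trans (Finset.le_sup' (fun σ => |Rσ σ|) (Finset.mem_univ σ))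
  -- Minkowski: `λ ∈ 𝔞 ∖ 0` small at every `σ ≠ σ₀`
  set 𝔞 : Ideal (𝓞 K) := n.prod fun v e => v.asIdeal ^ e with h𝔞
  have h𝔞0 : 𝔞 ≠ ⊥ := by
    rw [h𝔞, Finsupp.prod, ← Ideal.zero_eq_bot, Finset.prod_ne_zero_iff]
    intro v _
    exact pow_ne_zero _ (by rw [Ne, Ideal.zero_eq_bot]; exact v.ne_bot)
  have hδ : 0 < ε / (R + 1) := div_pos hε (by linarith)
  obtain ⟨r, hr𝔞, hr0, hrlt⟩ := exists_ne_zero_mem_ideal_forall_lt K 𝔞 h𝔞0 σ₀ hδ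
  set lam : K := (r : K) with hlam
  have hlam0 : lam ≠ 0 := fun h => hr0 (by
    apply FaithfulSMul.algebraMap_injective (𝓞 K) K
    rw [map_zero]; exact h)
  -- bring `λ⁻¹ x` into `K + (F × ∏ 𝒪_v)`
  set y : AdeleRing (𝓞 K) K := algebraMap K (AdeleRing (𝓞 K) K) lam⁻¹ * x with hy
  obtain ⟨k₁, hk₁⟩ := FiniteAdeleRing.exists_forall_sub_algebraMap_mem (𝓞 K) K y.2
  obtain ⟨m, hm⟩ := hFcov (y.1 - algebraMap K (InfiniteAdeleRing K) k₁)
  set k₀ : K := k₁ + (m : K) with hk₀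
  set w : AdeleRing (𝓞 K) K := y - algebraMap K (AdeleRing (𝓞 K) K) k₀ with hw
  have hw1 : w.1 ∈ F := by
    rw [hw, AdeleRing.fst_sub, AdeleRing.algebraMap_fst, hk₀, map_add, ← sub_sub]
    exact hm
  have hw2 : ∀ v, w.2 v ∈ v.adicCompletionIntegers K := fun v => by
    rw [hw, AdeleRing.snd_sub, AdeleRing.algebraMap_snd, hk₀, map_add, ← sub_sub,
      FiniteAdeleRing.sub_apply', FiniteAdeleRing.algebraMap_apply]
    exact sub_mem (hk₁ v) (HeightOneSpectrum.coe_algebraMap_mem (𝓞 K) K v m)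
  -- `k = λ k₀`, `x - k = λ w`
  refine ⟨lam * k₀, ?_, ?_⟩
  · intro σ hσ
    have hxk : (x - algebraMap K (AdeleRing (𝓞 K) K) (lam * k₀)).1 σ =
        (lam : σ.Completion) * w.1 σ := by
      have h : x - algebraMap K (AdeleRing (𝓞 K) K) (lam * k₀) =
          algebraMap K (AdeleRing (𝓞 K) K) lam * w := by
        rw [hw, hy, mul_sub, ← mul_assoc, ← map_mul, mul_inv_cancel₀ hlam0, map_one, one_mul,
          ← map_mul]
      rw [h]
      rfl
    rw [hxk, norm_mul]
    have hnorm : ‖(lam : σ.Completion)‖ = σ lam :=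
      (InfinitePlace.Completion.norm_coe σ (WithAbs.toAbs σ.1 lam)).trans rfl
    rw [hnorm]
    calc σ lam * ‖w.1 σ‖ ≤ ε / (R + 1) * R :=
          mul_le_mul (hrlt σ hσ).le (hRle σ _ hw1) (norm_nonneg _) hδ.le
      _ < ε := by
          rw [div_mul_eq_mul_div, div_lt_iff₀ (by linarith)]
          nlinarith
  · intro v
    have hxk : (x - algebraMap K (AdeleRing (𝓞 K) K) (lam * k₀)).2 v =
        algebraMap K (FiniteAdeleRing (𝓞 K) K) lam v * w.2 v := by
      have h : x - algebraMap K (AdeleRing (𝓞 K) K) (lam * k₀) =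
          algebraMap K (AdeleRing (𝓞 K) K) lam * w := by
        rw [hw, hy, mul_sub, ← mul_assoc, ← map_mul, mul_inv_cancel₀ hlam0, map_one, one_mul,
          ← map_mul]
      rw [h]
      rfl
    rw [hxk, Valuation.map_mul, valued_algebraMap_finiteAdele_apply]
    calc v.valuation K lam * Valued.v (w.2 v) ≤ WithZero.exp (-(n v : ℤ)) * 1 :=
          mul_le_mul' (valuation_le_exp_neg_of_mem_finsuppProd K hr𝔞 v)
            ((HeightOneSpectrum.mem_adicCompletionIntegers (𝓞 K) K v).mp (hw2 v))
      _ = WithZero.exp (-(n v : ℤ)) := mul_one _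

end Literature.NumberTheory.Automorphic
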